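import Literature.NumberTheory.Automorphic.EndoscopicPairShift        -- ★ p853274 F5-(3a) SHIFT KIT + ED. 2 `cast_ncard_vertex_rowZero_eq_of_total` (brings ★ (W1) `SelfDualLatticeFixOrderOnly`)
import HarnessLib

/-!
# LEVEL TWO of an abstract total: the `φ(g,u)`-stable vertices with `(φ(g,u) − 1)·M ⊆ ϖ²·M` number `G (n − 4) (N − 2)` (2-free, `d`-free, any residue characteristic)

Topic `NumberTheory/Automorphic`; namespace `Literature.NumberTheory.Automorphic.UnitaryLatticeTree` (T1a currency of ★ `UnitaryLatticeTreeDefs`: `[Valued K ℤᵐ⁰]`,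
`IsVertexLattice σ ϖ H d`, `scaleLattice`).  THEOREMS ONLY (no definition, no instance, no notation, no named fact, no `sorry`); kernel lane `--supports
stmt-HodgeConjecture-24833`.  Cell `pub/hodgecm-mathlib`, crux H413 = `stmt-HodgeConjecture-24833`, half-A line LH4; LEVEL-TWO row L2-6 of the D-UNR `h2`-map
(CENSUS-LEVEL2-h2 v1, LH4-p01 (g11)): the dyadic twin of ★ `exists_matched_pair_twoDeep_typeTwo` BY COUNTING needs the LEVEL-TWO class counts; this file is their
abstract core (W2), the level-`ϖ²` twin of ★ (W1) §4 `ncard_vertex_rowZero_eq_of_total` and of its `ℚ`-currency ★ ED. 2 `cast_ncard_vertex_rowZero_eq_of_total`.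
HONEST LABEL: HC_CM is proved only modulo the 7 printed citations (2 remaining named inputs hLiu418 = stmt-HodgeConjecture-24832, h413 = stmt-HodgeConjecture-24833) until
rung 0 closes; count-neutral module algebra over a valuation ring; (D-UNR) stays PRINT (its LEVEL-TWO lift `liftInterior_of_levelTwo` is untouched).

THE MATHEMATICS.  Exactly ★ (W1) §2–§4 with the shift scalar `c := ϖ²` in place of `c := ϖ`: by ★ `ncard_vertex_map_le_and_level_eq` (any `c ≠ 0`, `|c| ≤ 1`) the
vertices with `φ(g,u)·M ⊆ M ∧ (φ(g,u) − 1)·M ⊆ ϖ²·M` are the `η`-stable vertices for `η = ϖ⁻²(φ(g,u) − 1) = φ(g″, u″)`, `(g″, u″) = (ϖ⁻²•(g − 1), ϖ⁻²(u − 1))`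
(★ `smul_map_sub_one_eq_map_shift`), and the Eisenstein data of the twice-shifted pair are `Θ = (α + β)•1 + (βϖ²)•g″` (★ `theta_eq_smul_one_add_smul_shift`),
`u″•1 − g″ = (ϖ⁻²a)•1 + (ϖ⁻²b)•Θ` (★ `shift_smul_one_sub_shift_eq`), `|det(u″•1 − g″)| = |ϖ|^(n−4)` (★ `det_shift_smul_one_sub_shift`), `|ϖ⁻²b| = |ϖ|^(N−2)` — so the
TOT-Λ-shaped hypothesis at `(g″, u″)` gives the count `G (n − 4) (N − 2)` (guards `4 ≤ n`, `2 ≤ N`).  The side condition `C` is assumed at the twice-shifted pair (`hCg″`;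
its supplier for ★ γ's pair letters is ★ `shift_pairLetters` read with `ϖ ↦ ϖ²`, depth `|g − 1|, |u − 1| ≤ |ϖ²|`).

* §1 `v_inv_sq_pow_two_mul_eq`, `v_inv_sq_mul_eq` (valuation bookkeeping of the `ϖ²`-shift).
* §2 **`cast_ncard_vertex_levelTwo_eq_of_total`** (`ℚ`-currency, as ★ ED. 2) and `ncard_vertex_levelTwo_eq_of_total` (`ℕ`-currency, as ★ (W1) §4).

## References
* [Rogawski1990] J. D. Rogawski, *Automorphic Representations of Unitary Groups in Three Variables*, Ann. of Math. Stud. 123 (1990), §4.9 p. 55.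
* [Kottwitz1986BaseChangeUnits] R. E. Kottwitz, *Base change for unit elements of Hecke algebras*, Compositio Math. 60 (1986), §1 pp. 240–241, §2 pp. 244–247.
* [Jacobowitz1962] R. Jacobowitz, *Hermitian forms over local fields*, Amer. J. Math. 84 (1962), §4, §7.
-/

set_option autoImplicit false

noncomputable section

open Matrix
open scoped MatrixGroups ValuativeRel WithZero

namespace Literature.NumberTheory.Automorphic.UnitaryLatticeTree

open Literature.NumberTheory.Automorphic

variable {K : Type*} [Field K] [Valued K (WithZero (Multiplicative ℤ))] {N : ℕ}

/-! ## §1 Valuation bookkeeping of the `ϖ²`-shift -/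

/-- `v(x) = v(ϖ)^n`, `4 ≤ n` ⇒ `v((ϖ²)⁻¹ ^ 2 · x) = v(ϖ)^(n − 4)`. [cite: Jacobowitz1962, §4] -/
theorem v_inv_sq_pow_two_mul_eq {ϖ x : K} (hϖ : ϖ ≠ 0) {n : ℕ} (hn : 4 ≤ n) (hx : Valued.v x = Valued.v ϖ ^ n) :
    Valued.v ((ϖ ^ 2)⁻¹ ^ 2 * x) = Valued.v ϖ ^ (n - 4) := by
  have hϖ' : Valued.v ϖ ≠ 0 := (Valuation.ne_zero_iff _).2 hϖ
  obtain ⟨k, rfl⟩ := Nat.exists_eq_add_of_le hn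
  rw [map_mul, map_pow, map_inv₀, map_pow, hx, Nat.add_sub_cancel_left, pow_add, ← mul_assoc, ← inv_pow, ← pow_mul,
    show (2 * 2 : ℕ) = 4 by norm_num, inv_pow, inv_mul_cancel₀ (pow_ne_zero 4 hϖ'), one_mul]

/-- `v(b) = v(ϖ)^N`, `2 ≤ N` ⇒ `v((ϖ²)⁻¹ · b) = v(ϖ)^(N − 2)`. [cite: Jacobowitz1962, §4] -/
theorem v_inv_sq_mul_eq {ϖ b : K} (hϖ : ϖ ≠ 0) {M₀ : ℕ} (hM : 2 ≤ M₀) (hb : Valued.v b = Valued.v ϖ ^ M₀) :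
    Valued.v ((ϖ ^ 2)⁻¹ * b) = Valued.v ϖ ^ (M₀ - 2) := by
  have hϖ' : Valued.v ϖ ≠ 0 := (Valuation.ne_zero_iff _).2 hϖ
  obtain ⟨k, rfl⟩ := Nat.exists_eq_add_of_le hM
  rw [map_mul, map_inv₀, map_pow, hb, Nat.add_sub_cancel_left, pow_add, ← mul_assoc, inv_mul_cancel₀ (pow_ne_zero 2 hϖ'), one_mul]

/-! ## §2 LEVEL TWO = TOTAL AT THE TWICE-SHIFTED INVARIANTS -/

/-- **LEVEL TWO = TOTAL AT THE TWICE-SHIFTED INVARIANTS, `ℚ`-CURRENCY** — the `ϖ²` twin of ★ ED. 2 `cast_ncard_vertex_rowZero_eq_of_total`: under the same TOT-Λ-shaped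
hypothesis `hT` (count function `G n′ N′`, side condition `C` — assumed HERE at the twice-shifted pair `(ϖ⁻²•(g − 1), ϖ⁻²(u − 1))`), for Eisenstein data at `(n, N)` with
`4 ≤ n`, `2 ≤ N`, the `φ(g,u)`-stable vertices of type `d` with `(φ(g,u) − 1)·M ⊆ ϖ²·M` number `G (n − 4) (N − 2)`.
[cite: Rogawski1990, §4.9 p. 55] [cite: Kottwitz1986BaseChangeUnits, §2 pp. 244–247] [cite: Jacobowitz1962, §7] -/
theorem cast_ncard_vertex_levelTwo_eq_of_total (σ : K →+* K) {ϖ : K} (hϖ0 : ϖ ≠ 0) (hϖ1 : Valued.v ϖ ≤ 1) (H : Matrix (Fin N) (Fin N) K) (d : ℕ)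
    (φ : (Matrix (Fin 2) (Fin 2) K × K) →ₐ[K] Matrix (Fin N) (Fin N) K) (C : Matrix (Fin 2) (Fin 2) K → K → Prop) (G : ℕ → ℕ → ℚ)
    (hT : ∀ (g Θ : Matrix (Fin 2) (Fin 2) K) (u α β a b : K) (n' N' : ℕ), C g u → Θ = α • 1 + β • g → Valued.v Θ.det = Valued.v ϖ → Valued.v Θ.trace < 1 →
      u • 1 - g = a • 1 + b • Θ → Valued.v (u • 1 - g).det = Valued.v ϖ ^ n' → Valued.v b = Valued.v ϖ ^ N' →
      (({M : Submodule (Valued.integer K) (Fin N → K) | IsVertexLattice σ ϖ H d M ∧ M.map ((Matrix.toLin' (φ (g, u))).restrictScalars (Valued.integer K)) ≤ M}.ncard : ℕ) : ℚ) = G n' N')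
    {g Θ : Matrix (Fin 2) (Fin 2) K} {u α β a b : K} {n M₀ : ℕ} (hCg'' : C ((ϖ ^ 2)⁻¹ • (g - 1)) ((ϖ ^ 2)⁻¹ * (u - 1))) (hΘ : Θ = α • 1 + β • g)
    (hΘd : Valued.v Θ.det = Valued.v ϖ) (hΘt : Valued.v Θ.trace < 1) (hrel : u • 1 - g = a • 1 + b • Θ) (hn : Valued.v (u • 1 - g).det = Valued.v ϖ ^ n)
    (hb : Valued.v b = Valued.v ϖ ^ M₀) (hn4 : 4 ≤ n) (hN2 : 2 ≤ M₀) :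
    (({M : Submodule (Valued.integer K) (Fin N → K) | IsVertexLattice σ ϖ H d M ∧ M.map ((Matrix.toLin' (φ (g, u))).restrictScalars (Valued.integer K)) ≤ M ∧
        M.map ((Matrix.toLin' (φ (g, u) - 1)).restrictScalars (Valued.integer K)) ≤ scaleLattice (ϖ ^ 2) M}.ncard : ℕ) : ℚ) = G (n - 4) (M₀ - 2) := by
  have hc0 : (ϖ ^ 2 : K) ≠ 0 := pow_ne_zero 2 hϖ0
  have hc1 : Valued.v (ϖ ^ 2 : K) ≤ 1 := by rw [map_pow]; exact pow_le_one₀ zero_le hϖ1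
  rw [ncard_vertex_map_le_and_level_eq σ ϖ H d hc0 hc1 (φ (g, u)), smul_map_sub_one_eq_map_shift φ (ϖ ^ 2) g u]
  exact hT ((ϖ ^ 2)⁻¹ • (g - 1)) Θ ((ϖ ^ 2)⁻¹ * (u - 1)) (α + β) (β * ϖ ^ 2) ((ϖ ^ 2)⁻¹ * a) ((ϖ ^ 2)⁻¹ * b) (n - 4) (M₀ - 2) hCg''
    (theta_eq_smul_one_add_smul_shift hc0 hΘ) hΘd hΘt (shift_smul_one_sub_shift_eq hrel)
    (by rw [det_shift_smul_one_sub_shift, v_inv_sq_pow_two_mul_eq hϖ0 hn4 hn]) (v_inv_sq_mul_eq hϖ0 hN2 hb)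

/-- **LEVEL TWO = TOTAL AT THE TWICE-SHIFTED INVARIANTS, `ℕ`-CURRENCY** — the `ϖ²` twin of ★ (W1) §4 `ncard_vertex_rowZero_eq_of_total` (abstract count function `F`).
[cite: Rogawski1990, §4.9 p. 55] [cite: Kottwitz1986BaseChangeUnits, §2 pp. 244–247] [cite: Jacobowitz1962, §7] -/
theorem ncard_vertex_levelTwo_eq_of_total (σ : K →+* K) {ϖ : K} (hϖ0 : ϖ ≠ 0) (hϖ1 : Valued.v ϖ ≤ 1) (H : Matrix (Fin N) (Fin N) K) (d : ℕ)
    (φ : (Matrix (Fin 2) (Fin 2) K × K) →ₐ[K] Matrix (Fin N) (Fin N) K) (C : Matrix (Fin 2) (Fin 2) K → K → Prop) (F : ℕ → ℕ → ℕ)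
    (hT : ∀ (g Θ : Matrix (Fin 2) (Fin 2) K) (u α β a b : K) (n' N' : ℕ), C g u → Θ = α • 1 + β • g → Valued.v Θ.det = Valued.v ϖ → Valued.v Θ.trace < 1 →
      u • 1 - g = a • 1 + b • Θ → Valued.v (u • 1 - g).det = Valued.v ϖ ^ n' → Valued.v b = Valued.v ϖ ^ N' →
      {M : Submodule (Valued.integer K) (Fin N → K) | IsVertexLattice σ ϖ H d M ∧ M.map ((Matrix.toLin' (φ (g, u))).restrictScalars (Valued.integer K)) ≤ M}.ncard = F n' N')
    {g Θ : Matrix (Fin 2) (Fin 2) K} {u α β a b : K} {n M₀ : ℕ} (hCg'' : C ((ϖ ^ 2)⁻¹ • (g - 1)) ((ϖ ^ 2)⁻¹ * (u - 1))) (hΘ : Θ = α • 1 + β • g)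
    (hΘd : Valued.v Θ.det = Valued.v ϖ) (hΘt : Valued.v Θ.trace < 1) (hrel : u • 1 - g = a • 1 + b • Θ) (hn : Valued.v (u • 1 - g).det = Valued.v ϖ ^ n)
    (hb : Valued.v b = Valued.v ϖ ^ M₀) (hn4 : 4 ≤ n) (hN2 : 2 ≤ M₀) :
    {M : Submodule (Valued.integer K) (Fin N → K) | IsVertexLattice σ ϖ H d M ∧ M.map ((Matrix.toLin' (φ (g, u))).restrictScalars (Valued.integer K)) ≤ M ∧
        M.map ((Matrix.toLin' (φ (g, u) - 1)).restrictScalars (Valued.integer K)) ≤ scaleLattice (ϖ ^ 2) M}.ncard = F (n - 4) (M₀ - 2) := by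
  have hc0 : (ϖ ^ 2 : K) ≠ 0 := pow_ne_zero 2 hϖ0
  have hc1 : Valued.v (ϖ ^ 2 : K) ≤ 1 := by rw [map_pow]; exact pow_le_one₀ zero_le hϖ1
  rw [ncard_vertex_map_le_and_level_eq σ ϖ H d hc0 hc1 (φ (g, u)), smul_map_sub_one_eq_map_shift φ (ϖ ^ 2) g u]
  exact hT ((ϖ ^ 2)⁻¹ • (g - 1)) Θ ((ϖ ^ 2)⁻¹ * (u - 1)) (α + β) (β * ϖ ^ 2) ((ϖ ^ 2)⁻¹ * a) ((ϖ ^ 2)⁻¹ * b) (n - 4) (M₀ - 2) hCg''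
    (theta_eq_smul_one_add_smul_shift hc0 hΘ) hΘd hΘt (shift_smul_one_sub_shift_eq hrel)
    (by rw [det_shift_smul_one_sub_shift, v_inv_sq_pow_two_mul_eq hϖ0 hn4 hn]) (v_inv_sq_mul_eq hϖ0 hN2 hb)

end Literature.NumberTheory.Automorphic.UnitaryLatticeTree

end
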